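import Summits.QuantumFields.YangMills.Theorems.UnitScaleTiltHalvingHSiteTopH42Datum
import Literature.MathematicalPhysics.QuantumFieldTheory.Balaban1983to89.BlockAveragingEMLProp2
import HarnessLib

/-!
# Line H (`BirthV10.stub_halvingStep`, stmt-QuantumFields-19200): ★★ THE SMALL-`Cr` CORNER OF THE ε₁-ROUTE CLOSED — the `(K−n)`-fold average `V` of a
# printed-regular `U ∈ regFibrePr … ε₀ V` has plaquettes `< 2ε₀` (iterated [Balaban1985Averaging] Prop. 1 for (0.4)), so the `htop` row needs NO `ε₁` and NO `Cr`

Cell `ym3-torus` (HUMAN RULING D-0037: YM₃ on T³ is ladder rung R3 — NOT d = 4, NOT a mass gap, NOT the Clay problem), width seat `ym-ust-20520-w3` gen 7 (LEAD-H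
LOCATE-H42-TOP-w5g5 §2 «SMALL-`Cr` CORNER … exit (i): `PlaqSmall (C·ε₀) V` from `U ∈ regFibrePr … ε₀ V` by averaging ([Balaban1985Averaging] (208)–(214))»).
`--supports stmt-QuantumFields-19200 --as helper`; THEOREMS ONLY (0 `def`, 0 `sorry`); count-neutral; nothing here claims `hMember`, `hSupUρ3`, the stub, the crux or the gap.

THE POINT.  ✓`HalvingHSiteTopH42Datum.htop_of_knitGauge` bounds the top double-bar logarithms at the knit gauge by `2·d(M′+ρ′)·ε₁` from `PlaqSmall ε₁ V`, and the (1.42)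
window of ✓`P1FlatCoreTopH42.H42_top_guarded` then wants `ε₁ ≲ L·ε₀` — under the H door's prefix only `Cr·ε₁ ≤ ε₀` with `12(ρ+M)a ≤ Cr` is known, which does NOT make `ε₁`
small (LEAD-H's «small-`Cr` corner»).  But `V` IS the `(K−n)`-fold (0.4) average of `U` (`U ∈ fibre V`) and `U` is printed-regular: `PlaqSmall (ε₀·L^{−2(K−n)}) U` ((2) p.278).
One averaging step maps `PlaqSmall a` to `PlaqSmall (L²a + 143·((7L)²a∕4)²)` (lit ✓`BlockAveragingEMLProp2.plaqSmall_blockAvg_eml_sharp`, d = 3, SU(2)); iterating with the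
invariant `a_i ≤ ε₀·q^{m}·(1 + q^{m})`, `q := L^{−2}`, `m := K − n − i` (the quadratic corrections sum geometrically: `572·(49∕4)²·ε₀ ≤ 1 − L^{−2}` suffices, implied by
`10⁷L³ε₀ ≤ 1`) gives `PlaqSmall (2ε₀) V` — uniformly in `K − n`.  Hence the `htop` row at `ε₁ := 2ε₀`: `t = 4·d(M′+ρ′)·ε₀`, window `4·d(M′+ρ′)·ε₀ ≤ 1` — pure `ε₀`-lines.

WHAT.  §1 ★★ `plaqSmall_iter_of_regular` (the invariant at every height `i ≤ K − n`), ★★ `plaqSmall_two_mul_of_mem_regFibrePr` (`PlaqSmall (2ε₀) V`);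
§2 ★★ `htop_of_knitGauge_regular` — ✓`htop_of_knitGauge` with `PlaqSmall ε₁ V`, `0 ≤ ε₁` DISCHARGED at `ε₁ := 2ε₀`.  HONEST SCOPE: an induction over one landed estimate;
nothing of Prop. 3, Theorem 4 or the stub is proved here.

References: T. Bałaban, CMP **98** (1985) 17–51 [Balaban1985Averaging] (Prop. 1 (51) p.26, (208)–(214) p.50); CMP **102** (1985) 277–309 [Balaban1985Variational] ((2) p.278,
(6) p.278, (150)–(156) pp.301–302); CMP **109** (1987) 249–301 [Balaban1987RG1] ((0.11) p.253).
-/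

set_option autoImplicit false

noncomputable section

open scoped BigOperators Matrix.Norms.L2Operator
open NormedSpace
open Complex (I)

namespace Summit.QuantumFields.YangMills.Theorems.HalvingRegFibrePlaqDescent

open Literature.MathematicalPhysics.QuantumFieldTheory.Balaban1983to89
open T4Continuum
open Literature.MathematicalPhysics.QuantumFieldTheory.Balaban1983to89.T3ContinuumYM3Torus
open Literature.MathematicalPhysics.QuantumFieldTheory.Balaban1983to89.T3PrintedRegularMinimiser (RegPr regFibrePr mem_regFibrePr_iff)
open Literature.MathematicalPhysics.QuantumFieldTheory.Balaban1983to89.T3UnitLawDensityEML (ℰp)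
open T3RegularMinimiser (regThreshold)
open T3ConstrainedMinimiser (fibre)
open T3TiltDescent (descendTo)
open ExpMeanLog (deltaSU expMeanLogSU)
open MatrixLog (mlog)
open B5Eq118OneStroke (iterBlockOf)
open B7Prop1Explicit renaming Site → LSite
open B7Prop1Explicit (e)
open B7Eq92Concrete (mgauge)
open B8Eq131Cubes (cube gs)
open B8CubeMemberZd (cubeLamS cubeLamB)
open B8Eq184Proof (gaugeExp cfgExp)
open B10Eq27TorusAxialLog (rel pull unitsField toUField suIncl gaugeActT axialT)
open B15Eq112TorusCover (lift)
open Node00 (coverAt)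
open Summit.QuantumFields.YangMills.Theorems.Prop8ChartDoubleBar (dbarIterU vframeU)
open BlockAveragingEMLProp2 (plaqSmall_blockAvg_eml_sharp)
open HalvingHSiteTopH42Datum (htop_of_knitGauge)

/-! ## §1 The plaquettes of the iterated (0.4) average of a printed-regular field -/

section Descent

variable (F : T3Family) {n K : ℕ}

/-- ★★ **THE PLAQUETTES OF THE ITERATED AVERAGE OF A REGULAR FIELD** (iterated [Balaban1985Averaging] Prop. 1 for (0.4), d = 3, SU(2)): if
`PlaqSmall (ε₀·L^{−2(K−n)}) U` and `10⁷L³ε₀ ≤ 1`, then for every height `i ≤ K − n` the `i`-fold average has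
`PlaqSmall (ε₀·q^{m}·(1 + q^{m}))`, `q := L^{−2}`, `m := K − n − i` — one step by lit ✓`BlockAveragingEMLProp2.plaqSmall_blockAvg_eml_sharp`, the quadratic correction absorbed by
`572·(49∕4)²·ε₀ ≤ 1 − L^{−2}`. [cite: Balaban1985Averaging, Prop. 1 (51) p.26, (208)-(214) p.50; Balaban1987RG1, (0.11) p.253] -/
theorem plaqSmall_iter_of_regular {ε₀ : ℝ} (hε₀ : 0 < ε₀) (hε : 10 ^ 7 * (F.L : ℝ) ^ 3 * ε₀ ≤ 1)
    {U : GaugeField (F.P K) 0 (Matrix.specialUnitaryGroup (Fin 2) ℂ)} (hU : PlaqSmall (regThreshold F n K ε₀) U) :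
    ∀ i, i ≤ K - n →
      PlaqSmall (ε₀ * (((F.L : ℝ)⁻¹) ^ 2) ^ (K - n - i) * (1 + (((F.L : ℝ)⁻¹) ^ 2) ^ (K - n - i)))
        (Averaging.iter (fun j => BlockAveraging.blockAvg (P := F.P K) (j := j) ℰp) i U) := by
  have hL2 : (2 : ℝ) ≤ (F.L : ℝ) := by have := F.hL.2; exact_mod_cast this
  have hL0 : (0 : ℝ) < (F.L : ℝ) := by linarith
  have hLP : ((F.P K).L : ℝ) = (F.L : ℝ) := by norm_cast
  have hdP : (F.P K).d = 3 := T3Family.P_d F K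
  set q : ℝ := ((F.L : ℝ)⁻¹) ^ 2 with hq
  have hq0 : 0 < q := by positivity
  have hq1 : q ≤ 1 / 4 := by
    rw [hq, inv_pow]
    have h4 : (4 : ℝ) ≤ (F.L : ℝ) ^ 2 := by nlinarith
    calc ((F.L : ℝ) ^ 2)⁻¹ ≤ (4 : ℝ)⁻¹ := by
          exact inv_anti₀ (by norm_num) h4
      _ = 1 / 4 := by norm_num
  have hqle1 : q ≤ 1 := hq1.trans (by norm_num)
  have hLq : (F.L : ℝ) ^ 2 * q = 1 := by
    rw [hq, inv_pow, mul_inv_cancel₀ (pow_ne_zero _ hL0.ne')]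
  -- `ε₀` is tiny: `10⁷L³ε₀ ≤ 1`, `L ≥ 2`
  have hε₀s : (10 : ℝ) ^ 7 * 8 * ε₀ ≤ 1 := by
    have h8 : (8 : ℝ) ≤ (F.L : ℝ) ^ 3 := by nlinarith
    nlinarith
  intro i
  induction i with
  | zero =>
    intro _
    -- `iter 0 = id`; the regular threshold is `ε₀·q^{K−n} ≤ ε₀·q^{K−n}·(1 + q^{K−n})`
    have hle : regThreshold F n K ε₀ ≤ ε₀ * q ^ (K - n - 0) * (1 + q ^ (K - n - 0)) := by
      rw [Nat.sub_zero]
      have hreg : regThreshold F n K ε₀ = ε₀ * q ^ (K - n) := by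
        show ε₀ * ((F.L : ℝ)⁻¹) ^ (2 * (K - n)) = ε₀ * (((F.L : ℝ)⁻¹) ^ 2) ^ (K - n)
        rw [pow_mul]
      rw [hreg]
      have hqn : 0 ≤ q ^ (K - n) := pow_nonneg hq0.le _
      nlinarith [mul_nonneg hε₀.le hqn]
    exact fun p => (hU p).trans_le hle
  | succ i ih =>
    intro hi
    have hi' : i ≤ K - n := Nat.le_of_succ_le hi
    -- letters: `m := K − n − i ≥ 1`, `K − n − (i+1) = m − 1`
    obtain ⟨m, hm⟩ : ∃ m, K - n - i = m + 1 := ⟨K - n - (i + 1), by omega⟩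
    have hm' : K - n - (i + 1) = m := by omega
    have hih := ih hi'
    rw [hm] at hih
    rw [hm']
    -- the level-`i` radius and its bounds
    set a : ℝ := ε₀ * q ^ (m + 1) * (1 + q ^ (m + 1)) with ha
    have hqs : q ^ (m + 1) = q ^ m * q := pow_succ q m
    have hqm : 0 < q ^ m := pow_pos hq0 _
    have hqm1 : q ^ (m + 1) ≤ 1 := pow_le_one₀ hq0.le hqle1
    have hqmle : q ^ m ≤ 1 := pow_le_one₀ hq0.le hqle1
    have ha0 : 0 < a := by rw [ha]; positivity
    have ha2 : a ≤ 2 * ε₀ * q ^ (m + 1) := by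
      have hp : 0 ≤ ε₀ * q ^ (m + 1) := by positivity
      have h := mul_le_mul_of_nonneg_left hqm1 hp
      rw [ha]; nlinarith [h]
    -- `x := (49∕4)L²a ≤ y := (49∕2)ε₀q^m` (`L²q = 1`)
    have hxy : 49 / 4 * (F.L : ℝ) ^ 2 * a ≤ 49 / 2 * ε₀ * q ^ m := by
      have h1 : 49 / 4 * (F.L : ℝ) ^ 2 * a ≤ 49 / 4 * (F.L : ℝ) ^ 2 * (2 * ε₀ * q ^ (m + 1)) :=
        mul_le_mul_of_nonneg_left ha2 (by positivity)
      have h2 : 49 / 4 * (F.L : ℝ) ^ 2 * (2 * ε₀ * q ^ (m + 1)) = 49 / 2 * ε₀ * q ^ m * ((F.L : ℝ) ^ 2 * q) := by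
        rw [hqs]; ring
      rw [h2, hLq, mul_one] at h1
      exact h1
    -- the one-step side condition `((d+4)L)²∕4 · a ≤ δ∕2`
    have hc : ((((F.P K).d + 4) * (F.P K).L : ℕ) : ℝ) ^ 2 / 4 = 49 / 4 * (F.L : ℝ) ^ 2 := by
      rw [hdP]; push_cast; rw [hLP]; ring
    have hs : ((((F.P K).d + 4) * (F.P K).L : ℕ) : ℝ) ^ 2 / 4 * a ≤ deltaSU (Fin 2) / 2 := by
      rw [hc]
      have h3 : 49 / 2 * ε₀ * q ^ m ≤ 49 / 2 * ε₀ := by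
        have h := mul_le_mul_of_nonneg_left hqmle (by positivity : (0 : ℝ) ≤ 49 / 2 * ε₀)
        rwa [mul_one] at h
      have h4 : (49 : ℝ) / 2 * ε₀ ≤ 1 / 6 := by linarith
      -- `1∕3 ≤ δ_{SU(2)} = min (1∕3) (π∕2)` (cf. ✓`HistoryTailBoundedHeight.third_le_deltaSU_two`)
      have hδ : (1 : ℝ) / 3 ≤ deltaSU (Fin 2) := by
        unfold deltaSU
        rw [Fintype.card_fin]
        refine le_min le_rfl ?_
        have hπ : (3 : ℝ) < Real.pi := Real.pi_gt_three
        rw [div_le_div_iff₀ (by norm_num) (by norm_num)]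
        push_cast
        linarith
      linarith
    -- ONE STEP (lit Prop. 1 for (0.4))
    have hstep := plaqSmall_blockAvg_eml_sharp (P := F.P K) (j := i) (n := Fin 2) ha0 hih hs
    -- the new radius is below the invariant at `m`
    have hle : ((F.P K).L : ℝ) ^ 2 * a + 143 * (((((F.P K).d + 4) * (F.P K).L : ℕ) : ℝ) ^ 2 / 4 * a) ^ 2 ≤
        ε₀ * q ^ m * (1 + q ^ m) := by
      rw [hc, hLP]
      -- `L²a = ε₀ q^m (1 + q^m·q)`
      have h1 : (F.L : ℝ) ^ 2 * a = ε₀ * q ^ m * (1 + q ^ m * q) := by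
        have : (F.L : ℝ) ^ 2 * a = ε₀ * q ^ m * (1 + q ^ m * q) * ((F.L : ℝ) ^ 2 * q) := by rw [ha, hqs]; ring
        rw [this, hLq, mul_one]
      -- the quadratic correction `143·x² ≤ 143·y² = (343343∕4)·ε₀·(ε₀ (q^m)²)`
      have hx0 : 0 ≤ 49 / 4 * (F.L : ℝ) ^ 2 * a := by positivity
      have h2 : (49 / 4 * (F.L : ℝ) ^ 2 * a) ^ 2 ≤ (49 / 2 * ε₀ * q ^ m) ^ 2 := pow_le_pow_left₀ hx0 hxy 2
      have h4 : 143 * (49 / 2 * ε₀ * q ^ m) ^ 2 = 343343 / 4 * ε₀ * (ε₀ * (q ^ m) ^ 2) := by ring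
      -- the room: `(343343∕4)·ε₀ ≤ 1 − q` (`8·10⁷·ε₀ ≤ 1`, `q ≤ 1∕4`)
      have hroom : 343343 / 4 * ε₀ ≤ 1 - q := by linarith
      have hpos : 0 ≤ ε₀ * (q ^ m) ^ 2 := by positivity
      have h5 : 343343 / 4 * ε₀ * (ε₀ * (q ^ m) ^ 2) ≤ (1 - q) * (ε₀ * (q ^ m) ^ 2) := mul_le_mul_of_nonneg_right hroom hpos
      calc (F.L : ℝ) ^ 2 * a + 143 * (49 / 4 * (F.L : ℝ) ^ 2 * a) ^ 2
          ≤ (F.L : ℝ) ^ 2 * a + 143 * (49 / 2 * ε₀ * q ^ m) ^ 2 := by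
            have h := mul_le_mul_of_nonneg_left h2 (by norm_num : (0 : ℝ) ≤ 143)
            linarith
        _ = ε₀ * q ^ m * (1 + q ^ m * q) + 343343 / 4 * ε₀ * (ε₀ * (q ^ m) ^ 2) := by rw [h1, h4]
        _ ≤ ε₀ * q ^ m * (1 + q ^ m * q) + (1 - q) * (ε₀ * (q ^ m) ^ 2) := by linarith
        _ = ε₀ * q ^ m * (1 + q ^ m) := by ring
    -- `iter (i+1) = blockAvg ∘ iter i` and monotonicity of `PlaqSmall`
    exact fun p => (hstep p).trans_le hle

/-- ★★ **`PlaqSmall (2ε₀) V` FOR `U ∈ regFibrePr F n K _ ε₀ V`** (`10⁷L³ε₀ ≤ 1`): the boundary field `V = D_{n,K}U` of a printed-regular configuration has plaquettes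
within `2ε₀` of `1` — §1's invariant at height `K − n` through the level identification (lit ✓`T3CruxEstimates.plaqSmall_fieldShift`).
[cite: Balaban1985Averaging, Prop. 1 (51) p.26, (208)-(214) p.50; Balaban1985Variational, (2) p.278, (6) p.278; Balaban1987RG1, (0.11) p.253] -/
theorem plaqSmall_two_mul_of_mem_regFibrePr (hnK : n ≤ K) {ε₀ : ℝ} (hε₀ : 0 < ε₀) (hε : 10 ^ 7 * (F.L : ℝ) ^ 3 * ε₀ ≤ 1)
    {V : GaugeField (F.P n) 0 (Matrix.specialUnitaryGroup (Fin 2) ℂ)} {U : GaugeField (F.P K) 0 (Matrix.specialUnitaryGroup (Fin 2) ℂ)}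
    (hU : U ∈ regFibrePr F n K hnK ε₀ V) : PlaqSmall (2 * ε₀) V := by
  obtain ⟨hUV, hUreg⟩ := (mem_regFibrePr_iff F).1 hU
  have h := plaqSmall_iter_of_regular F (n := n) (K := K) hε₀ hε hUreg.1 (K - n) le_rfl
  rw [Nat.sub_self, pow_zero, mul_one, show (1 : ℝ) + 1 = 2 by norm_num, mul_comm] at h
  have hV : descendTo F ℰp n K hnK U = V := hUV
  rw [← hV]
  exact (T3CruxEstimates.plaqSmall_fieldShift F _ (2 * ε₀) _).2 h

end Descent

/-! ## §2 The `htop` row with the small-`Cr` corner closed -/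

section Member

variable (F : T3Family) {n K : ℕ}

/-- ★★ **THE `htop` ROW AT THE KNIT GAUGE, ε₁-FREE** — ✓`HalvingHSiteTopH42Datum.htop_of_knitGauge` at `ε₁ := 2ε₀` with `PlaqSmall (2ε₀) V` DISCHARGED from
`U ∈ regFibrePr … ε₀ V` (§1): `‖log U̿^{(k)}((U♯)^{g′})(⟨π_k c₋, c.dir⟩)‖ ≤ 2·d(M′+ρ′)·(2ε₀)` on every top constraint bond, under the one window `2·d(M′+ρ′)·(2ε₀) ≤ 1`.
Same letters as ✓`htop_of_knitGauge` minus `hε₁ V hV`. [cite: Balaban1985Averaging, (8) p.19, (97)-(100) p.32, Prop. 1 (51) p.26; Balaban1985Variational, (2) p.278, (150)-(156) pp.301-302; Balaban1985RegularSpaces, (1.42) p.83] -/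
theorem htop_of_knitGauge_regular (hnK : n < K) (x₀ : Site (F.P K) 0) {a : LSite (F.P K).d} {M' ρ' : ℕ} (hρ'1 : 1 ≤ ρ')
    (ha : ∀ ν, a ν ≤ ((iterBlockOf (K - n) x₀ ν).val : ℤ) ∧ ((iterBlockOf (K - n) x₀ ν).val : ℤ) ≤ a ν + M' - 1)
    (hroomW : 2 * ((F.P K).L ^ (K - n) * (M' + 1) + ρ' * gs (F.P K).L (K - n)) ≤ (F.P K).sitesPerDir 0)
    {ε₀ : ℝ} (hε₀ : 0 < ε₀) (hε : 10 ^ 7 * (F.L : ℝ) ^ 3 * ε₀ ≤ 1)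
    {V : GaugeField (F.P n) 0 (Matrix.specialUnitaryGroup (Fin 2) ℂ)}
    (U : GaugeField (F.P K) 0 (Matrix.specialUnitaryGroup (Fin 2) ℂ)) (hU : U ∈ regFibrePr F n K hnK.le ε₀ V)
    (gJ : GaugeTransf (F.P K) 0 (Matrix.specialUnitaryGroup (Fin 2) ℂ))
    {u₁ : LSite (F.P K).d → (Matrix (Fin 2) (Fin 2) ℂ)ˣ} {W : LSite (F.P K).d → Fin (F.P K).d → (Matrix (Fin 2) (Fin 2) ℂ)ˣ}
    {A : LSite (F.P K).d → Fin (F.P K).d → Matrix (Fin 2) (Fin 2) ℂ}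
    (hu₁SU : ∀ z, ((u₁ z : (Matrix (Fin 2) (Fin 2) ℂ)ˣ) : Matrix (Fin 2) (Fin 2) ℂ) ∈ Matrix.specialUnitaryGroup (Fin 2) ℂ)
    (hW : mgauge (1 : LSite (F.P K).d → Fin (F.P K).d → (Matrix (Fin 2) (Fin 2) ℂ)ˣ) u₁ W = pull (unitsField (toUField (GaugeField.gaugeAct gJ U))) 0)
    {c₁ c' : ℝ} (hc' : 0 ≤ c') (hbudget : 8 * 3800 * ((((F.P K).d + 2) * (F.P K).L : ℕ) : ℝ) ^ 2 * c' ≤ 1)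
    (hc₁ : Real.exp c₁ - 1 ≤ ((F.L : ℝ)⁻¹) ^ (K - n) * c')
    (hchartTop : ∀ z ∈ cube (F.P K).L a M' ρ' (K - n) (K - n), ∀ ν : Fin (F.P K).d,
      W z ν = cfgExp (((F.L : ℝ)⁻¹) ^ (K - n)) A z ν ∧ ((F.L : ℝ)⁻¹) ^ (K - n) * ‖A z ν‖ ≤ c₁)
    {κf : (Site (F.P K) 0 → Matrix (Fin 2) (Fin 2) ℂ) → (i : ℕ) → GaugeTransf (F.P K) i (Matrix (Fin 2) (Fin 2) ℂ)ˣ}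
    (hκfs : ∀ (m : Site (F.P K) 0 → Matrix (Fin 2) (Fin 2) ℂ) (i : ℕ) (y : Site (F.P K) (i + 1)),
      κf m (i + 1) y = (vframeU (gaugeActT (κf m i) (dbarIterU i (gaugeActT
        (fun s => (u₁ (lift (F.P K) x₀ + rel x₀ s))⁻¹ * Unitary.toUnits (suIncl (gJ s)) : GaugeTransf (F.P K) 0 (Matrix (Fin 2) (Fin 2) ℂ)ˣ)
        (unitsField (toUField U))))) y)⁻¹ * κf m i (emb y) *
        vframeU (dbarIterU i (gaugeActT
          (fun s => (u₁ (lift (F.P K) x₀ + rel x₀ s))⁻¹ * Unitary.toUnits (suIncl (gJ s)) : GaugeTransf (F.P K) 0 (Matrix (Fin 2) (Fin 2) ℂ)ˣ)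
          (unitsField (toUField U)))) y)
    (hκf0 : ∀ (m : Site (F.P K) 0 → Matrix (Fin 2) (Fin 2) ℂ) (x : Site (F.P K) 0), ((κf m 0 x : (Matrix (Fin 2) (Fin 2) ℂ)ˣ) : Matrix (Fin 2) (Fin 2) ℂ) = exp (m x))
    {lam : LSite (F.P K).d → Matrix (Fin 2) (Fin 2) ℂ} (hsa : ∀ x, IsSelfAdjoint (lam x)) (htr : ∀ x, (lam x).trace = 0)
    (htopRow : ∀ yc ∈ cubeLamS (F.P K).L a M' ρ' (K - n) (K - n) (K - n),
      κf (((-I) • lam) ∘ fun s : Site (F.P K) 0 => lift (F.P K) x₀ + rel x₀ s) (K - n) (coverAt (F.P K) (K - n) yc) =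
        axialT (dbarIterU (K - n) (gaugeActT
          (fun s => (u₁ (lift (F.P K) x₀ + rel x₀ s))⁻¹ * Unitary.toUnits (suIncl (gJ s)) : GaugeTransf (F.P K) 0 (Matrix (Fin 2) (Fin 2) ℂ)ˣ)
          (unitsField (toUField U)))) (iterBlockOf (K - n) x₀) (coverAt (F.P K) (K - n) yc))
    (hε₀l : 2 * ((((F.P K).d * (M' + ρ') : ℕ) : ℝ) * (2 * ε₀)) ≤ 1) :
    ∀ c ∈ cubeLamB (F.P K).L a M' ρ' (K - n) (K - n) (K - n),
      ‖mlog ((dbarIterU (K - n) (gaugeActT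
          (fun s => ((u₁ * gaugeExp lam) (lift (F.P K) x₀ + rel x₀ s))⁻¹ * Unitary.toUnits (suIncl (gJ s)) :
            GaugeTransf (F.P K) 0 (Matrix (Fin 2) (Fin 2) ℂ)ˣ) (unitsField (toUField U)))
          ⟨coverAt (F.P K) (K - n) c.1, c.2⟩ : (Matrix (Fin 2) (Fin 2) ℂ)ˣ) : Matrix (Fin 2) (Fin 2) ℂ)‖ ≤
        2 * ((((F.P K).d * (M' + ρ') : ℕ) : ℝ) * (2 * ε₀)) :=
  htop_of_knitGauge F hnK x₀ hρ'1 ha hroomW hε₀ hε (by positivity) V (plaqSmall_two_mul_of_mem_regFibrePr F hnK.le hε₀ hε hU)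
    U hU gJ hu₁SU hW hc' hbudget hc₁ hchartTop hκfs hκf0 hsa htr htopRow hε₀l

end Member

end Summit.QuantumFields.YangMills.Theorems.HalvingRegFibrePlaqDescent

end
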